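import Mathlib
import HarnessLib
import HarnessLib.Audit
import Summits.AtomisticToContinuum.Statement

/-!
Route: DispersalNoHiddenCharges

CLOSED (retired) 2026-08-15T13:41:49Z by operator:999:1257524 — reason: not-a-thesis: assembly does not conclude the sub-problem Statement — note: D-0027 §2.1 audit (human 2026-08-15: routes that do not decide the summit are removed): the assembly concludes `Literature.MathematicalPhysics.KineticTheory.HydrodynamicLimit`, not the sub-problem statement; a NEW conforming route may be opened from the same idea (generated `closes : … → _root_.Hydr. The file is kept as the record of this route; refuted decls are indexed as negative knowledge (`ledger negatives`).

# Route DispersalNoHiddenCharges — no hidden charges — dispersal trivialises local densities, one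
stability exponent decides pseudo-local completeness, zero excess Drude weight feeds Yau's Gronwall

It suffices to show X = A ∧ B ∧ C ∧ D (card dispersal-no-hidden-charges: both strokes, plus the
consumer step it names).
(A) LOCAL CHARGES ARE TRIVIAL [typed: LocalChargesTrivial]: for hard spheres of diameter ε in ℝ³,
every range-R, translation-covariant local density q of FINITE clouds whose charge Q_N = Σ_i q(cloud
seen from i within R) is conserved by the hard-sphere flow (a.e. datum, every N) has Q_N = Σ_i (a +
b·v_i + c|v_i|²) a.e., with (a, b, c) independent of N — dispersal (no bound states, finitely many
collisions) plus the measurable Boltzmann–Gronwall lemma.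
(B) SUBLINEAR DISPERSAL STABILITY [informal until Spohn's fluctuation space ℋ_U is a Lean object]:
over the low-density infinite-volume hard-sphere Gibbs state, a range-R quasi-local density with
production ‖Lq‖_ℋ ≤ ε‖q‖_ℋ lies within κ(R)·ε‖q‖ of (charges ⊕ null densities), and κ(R) = o(R).
(C) DISPERSAL CRITERION [informal]: (A) ∧ (B) ⇒ Ker_ℋ L = span{n, p₁, p₂, p₃, e} (pseudo-local
completeness: Cesàro approximants of an invariant vector are quasi-local of range R + vT with
production ≤ 2/T; sublinear κ wins the competition). Its consumable finite-volume shadow is typed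
now: KineticStressDrudeVanishes — zero Cesàro Drude weight of the kinetic shear stress Σ_i
v_{i,1}v_{i,2} under the equilibrium law of the conjunct's own torus dynamics, uniformly in N (N → ∞
before the window L → ∞) — by the tree's Suzuki/Mazur dichotomy
(Literature.Barriers.AtomisticToContinuum.MazurBoundBallisticNarrow, conjunct (2)) plus a torus ↔
infinite-volume transfer at fixed microscopic window.
(D) COMPLETENESS TO EULER [informal; the sufficiency theorem of card
local-flux-gibbsianity-ballwise, shared]: zero excess Drude weights of the projected currents +
second-order current response along invariant states + velocity tails close Yau's relative-entropy
Gronwall ball-wise against invariant Gibbs references ⇒ RelEntropyVanishing (typed target, =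
stmt-AtomisticToContinuum-0766) ⇒ HydrodynamicLimit (assembly = stmt-AtomisticToContinuum-0769,
entropy inequality).
Lean: `LocalChargesTrivial ∧ KineticStressDrudeVanishes ∧ RelEntropyVanishing`

## Assembly
The typed spine is the board's standard one, shared by signature with routes RelEntropyErgodic,
ChaoticMixing and VanishingNoise: RelEntropyVanishing → HydrodynamicLimit by the entropy inequality
μ(A) ≤ (log 2 + H(μ|λ))/log(1 + 1/λ(A)) with λ(A) ≤ C e^{-(N+1)/C} (KipnisLandim1999 App. 1 Prop.
8.2; item stmt-AtomisticToContinuum-0769). Upstream of the target the chain is (A)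
LocalChargesTrivial ∧ (B) SublinearDispersalStability ⇒ (C) completeness Ker_ℋ L = 𝒞 ⇒
(Suzuki/Mazur, tree-proved, + transfer) KineticStressDrudeVanishes and siblings ⇒ (D, with
second-order response and tails, ball-wise Gronwall of card local-flux-gibbsianity-ballwise)
RelEntropyVanishing; (B), (C), (D) are informal items until ℋ_U is defined, so they enter the Lean
assembly only through the target.

Rationale: WHY THIS LINE. Conservation laws are tested by letting the gas fly apart: whatever a local observer
can conserve must survive dispersal into isolated spheres, and under transversal (d = 3) elastic
reflections only mass, momentum and energy do (Boltzmann–Gronwall: CercignaniIllnerPulvirenti1994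
§3.1; measurable/L¹_loc versions Arkeryd1972 = doi:10.1007/bf00253392, Cercignani1990 =
doi:10.1007/bf01026552; finitely many collisions of finitely many balls in all space: Vaserstein1979
= doi:10.1007/bf01941323, Illner1989 = doi:10.1080/00411458908214499, BuragoFerlegerKononenko1998) —
this is the hard-core, three-line counterpart of the Gurevich–Suhov first-integral theorem
(GurevichSuhov1976, doi:10.1007/bf01609838, doi:10.1007/bf01208482; smooth potentials) and the
classical counterpart of Shiraishi's finite-range induction for quantum chains (Shiraishi2019,
doi:10.1103/physrevb.109.035123). The infinite-volume question every linear card on the board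
assumes — finite-dimensionality of the space of pseudo-local conserved charges, "perhaps the most
important open problem, a seemingly very difficult one" of the hydrodynamic-projection framework
(Doyon2022 = arXiv:2011.00611, §1 p. 5) — is then only how FAST almost-conservation is unmasked: a
Hyers–Ulam stability constant κ(R) of theorem (A) in the Gibbs-weighted norm, against the 1/T
production of Cesàro approximants; the whole "non-integrability of the hard-sphere gas" is
compressed into one growth exponent, κ(R) = o(R), with κ ≍ R the trivial and exactly borderline
bound (slow near-parallel sub-clouds are the seeds of hydrodynamic modes). Imported areas: classical
scattering theory (asymptotic completeness / dispersal of repulsive N-body systems,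
number-of-collisions bounds from semi-dispersing billiards), functional equations of kinetic theory
(summational invariants and their quantitative stability), Hyers–Ulam stability, and the
Hilbert-space ergodic theory already PROVED in the tree (von Neumann / Suzuki / Mazur:
Literature.Barriers.AtomisticToContinuum.MazurBoundBallisticNarrow), with Spohn1991 §7.1
((7.13)–(7.18), p. 88) as the target conjecture at the linear level. What it does that the open
routes do not: RelEntropyErgodic asks the full Gibbs classification of finite-entropy stationary
states (stmt-0779), ChaoticMixing asks n-uniform mixing RATES in closed cells (stmt-0830); this line
asks only for the KERNEL of the Liouvillian in one equilibrium state (single state, L², zero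
frequency), proves its strictly local case outright, reduces the pseudo-local case to one exponent,
and files the consumable output (zero excess Drude weight) as a typed, MD-refutable statement about
the conjunct's own objects. Negatives index empty at filing; no refuted statement is re-used.

RANKED CRUXES. Typed now: LocalChargesTrivial (rank 3), KineticStressDrudeVanishes (rank 4),
supports MeasurableCollisionInvariant and FiniteCollisionsAllSpace, the shared target
RelEntropyVanishing and the shared Assembly. Filed informally right after open (no Lean object for
the infinite-volume Gibbs state / fluctuation space yet; definition requests below): rank 2
SublinearDispersalStability = (B) (the hardest and most informative step: why it might fail —
near-parallel slow sub-clouds and re-correlating collisions with the positive-density background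
could force κ ≳ R; sources Doyon2022 §1, Shiraishi2019, Cercignani1990, Desvillettes–Villani
doi:10.1007/s00222-004-0389-9 §IV), rank 5 DispersalCriterion = (C) ((A) ∧ (B) ⇒ Ker_ℋ L = 𝒞; why it
might fail — Maxwellian tails make Cesàro approximants only quasi-local, and the tail of the range
must be absorbed into κ), rank 6 CompletenessToEuler = (D) (shared with card
local-flux-gibbsianity-ballwise; why it might fail — a soft anomalous family of stationary states
with current ~ entropy^γ, γ < 1, survives zero Drude weight), support CompletenessToDrude (Ker_ℋ L =
𝒞 ⇒ KineticStressDrudeVanishes and its heat/collisional siblings: Suzuki dichotomy, tree-proved, +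
torus/infinite-volume transfer at fixed microscopic window).
#0 RelEntropyVanishing (target) — Yau's relative-entropy form of the hydrodynamic limit for
deterministic hard spheres at fixed reduced density (verbatim the shared item
stmt-AtomisticToContinuum-0766 of routes RelEntropyErgodic / ChaoticMixing / VanishingNoise): for
all continuous profiles ∃ σ₀ ∀ σ < σ₀ ∀ classical hs-Euler solutions on [0,T) ∀ flows, ∀ t < T there
is an activity profile a_t whose local Gibbs law concentrates the three empirical fields
exponentially around (ρ, ρu, E)(t) and H(f_t | localGibbs a_t u_t θ_t)/(N+1) → 0. (why it might
fail: in substance the open conjunct: deterministic spheres may fail to keep local equilibrium on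
Euler times; with (D) it inherits every failure mode of zero-excess-Drude-weight + second-order
response + velocity tails.) [OllaVaradhanYau1993, Yau1991, Spohn1991]
#3 LocalChargesTrivial (crux) — theorem (A) of card dispersal-no-hidden-charges, stated for finite
clouds in ℝ³ as the novelty audit asked: fix a diameter ε > 0, a range R and a function q of rooted
local patterns (the multiset of (x_j − x_i, v_j) over the spheres j within distance R of sphere i,
root included); let Q_N(z) = Σ_i q(pattern at i). If v ↦ q{(0, v)} is locally integrable and, for
every N and every hard-sphere flow of N spheres of diameter ε in ℝ³, Q_N(Φ_t z) = Q_N(z) for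
Liouville-a.e. z and all t, then there are a, c ∈ ℝ, b ∈ ℝ³ with Q_N(z) = Σ_i (a + ⟨b, v_i⟩ +
c|v_i|²) for every N and a.e. z. Proof plan: N = 2 clouds that collide after being R-separated give
φ(v)+φ(w) = φ(v′)+φ(w′) for a.e. (v, w, n) (collision-cylinder change of variables), φ(v) :=
q{(0,v)}; MeasurableCollisionInvariant makes φ quadratic a.e.; for general N,
FiniteCollisionsAllSpace + measure preservation give, for a.e. z, a last collision, pairwise
distinct outgoing velocities and eventual R-isolation, so Q_N(z) = Σ_i φ(v_i^out) = N a + ⟨b, P⟩ +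
2cE. [deps: MeasurableCollisionInvariant, FiniteCollisionsAllSpace] [difficulty: M] (why it might
fail: Only through step (i): it needs, for every N, that a.e. cloud has a LAST collision and then
R-isolates with pairwise distinct outgoing velocities (Vaserstein1979/Illner1989 finiteness,
unformalised; d = 1 analogue is false: rods swap velocities) and that z ↦ v_out pushes Liouville to
a.c. laws.) [Vaserstein1979, Illner1989, BuragoFerlegerKononenko1998, Arkeryd1972, Cercignani1990,
CercignaniIllnerPulvirenti1994, GurevichSuhov1976]
#4 KineticStressDrudeVanishes (crux) — the consumable output of (C) on the conjunct's own objects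
(D1 of card local-flux-gibbsianity-ballwise, kinetic shear-stress channel; crux B of
hydrodynamic-projection-transplant and (ii) of classical-mourre-koopman-completeness in Cesàro
form): for every temperature θ > 0 there is σ₀ > 0 such that for 0 < σ < σ₀, every family of torus
hard-sphere flows Φ_N of N+1 spheres of diameter ε_N = σ(N+1)^{-1/3}, and every δ > 0, there is L₀
with: for all L ≥ L₀, eventually in N, E_{G_N}[ (τ⁻¹ ∫_0^τ S(Φ_{N,s} z) ds)² ] ≤ δ (N+1), where τ =
L ε_N (time to fly L diameters ≍ L·σ³ mean free times), S(z) = Σ_i v_{i,1} v_{i,2} (kinetic shear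
stress, orthogonal under G_N to particle number, momentum and energy by reflection symmetry) and G_N
= localGibbsLaw σ 1 0 θ (constant profiles — activity cancels in the canonical normalisation: the
flow-invariant canonical hard-sphere Gibbs law with Maxwellian velocities at temperature θ).
Equivalently lim_L limsup_N (N+1)⁻¹ Var(time average) = 0: no excess (non-hydrodynamic) Drude weight
in the shear channel, N → ∞ BEFORE L → ∞ (finite-N products such as P₁P₂ contribute θ²/(N+1) only).
[deps: LocalChargesTrivial] [difficulty: open-problem] (why it might fail: False for the ideal gas
(S conserved: plateau θ²) and whenever an extensive conserved charge overlaps v₁v₂ (Mazur); at fixed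
σ a slow non-hydrodynamic mode or a stress autocorrelation that is not Cesàro-null keeps the plateau
positive; no theorem controls time correlations of deterministic spheres.) [Spohn1991, Doyon2022,
Mazur1969, AlderGassWainwright1970,
Literature.Barriers.AtomisticToContinuum.MazurBoundBallisticNarrow, OllaVaradhanYau1993]
#9 MeasurableCollisionInvariant (support) — measurable Boltzmann–Gronwall lemma in ℝ³ with
unnormalised impact directions (the tree's `reflectVel`): a locally integrable φ : ℝ³ → ℝ with φ(v)
+ φ(w) = φ(v′) + φ(w′) for Lebesgue-a.e. (v, w, n), (v′, w′) = reflectVel n (v, w), agrees a.e. with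
a + ⟨b, v⟩ + c|v|². Route: Galilean shifts preserve the equation, so mollification reduces to the
smooth case (CercignaniIllnerPulvirenti1994 §3.1; Arkeryd1972; Cercignani1990), and the
5-dimensional target space is closed under a.e. limits. [difficulty: provable-now] [Arkeryd1972,
Cercignani1990, CercignaniIllnerPulvirenti1994]
#9 FiniteCollisionsAllSpace (support) — finitely many collisions in all space (Vaserstein1979;
Illner1989 = doi:10.1080/00411458908214499, Illner1990 = doi:10.1080/00411459008260824; uniform
bounds BuragoFerlegerKononenko1998): for every ε > 0, N and hard-sphere flow of N spheres of
diameter ε in ℝ³ (Alexander's theorem in ℝ³ is the tree theorem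
`Literature.Analysis.FluidPDE.HardSphereFlow.nonempty_holds`), for Liouville-a.e. datum the set of
all collision times of its orbit is finite. Print proves it for every non-degenerate orbit; the a.e.
form is what (A) consumes. [difficulty: L] [Vaserstein1979, Illner1989, BuragoFerlegerKononenko1998,
Alexander1975]

TWO-LAYER PLAN. Foreseen glued splits (none filed now): LocalChargesTrivial ⇐ TwoBodyInvariant (N =
2, R-separated colliding pairs ⇒ φ is an a.e. collision invariant) → DispersalIdentity (a.e. cloud:
Q_N(z) = Σ φ(v_i^out)) → LocalChargesTrivial; KineticStressDrudeVanishes ⇐ CompletenessHS (typed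
once ℋ_U exists) → TorusTransfer (fixed-window torus variances → ℋ-norms as N → ∞) →
KineticStressDrudeVanishes; SublinearDispersalStability ⇐ FreeFlightKappa (κ ≍ R for the ideal gas
on 𝒟^⊥, explicit Gaussian integrals) → CollisionalGain (collisions with the Gibbs background buy
R^{1−a}) → SublinearDispersalStability (k ≤ 3, depth 1 each).

KILL CRITERIA. ¬KineticStressDrudeVanishes (a positive Cesàro plateau of the per-particle
shear-stress variance at arbitrarily small σ — i.e. an extensive conserved charge of the infinite
gas overlapping v₁v₂, or a non-Cesàro-null stress autocorrelation) closes this route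
`refuted:KineticStressDrudeVanishes` and simultaneously kills D1 of local-flux-gibbsianity-ballwise,
crux B of hydrodynamic-projection-transplant and output (ii) of
classical-mourre-koopman-completeness. ¬LocalChargesTrivial would exhibit a fourth local collision
invariant of the 3-D hard-sphere gas — a sensation; it closes (A) and forces (B)–(C) to be restated
over the enlarged charge space (pivot, not death). SublinearDispersalStability refuted (κ(R) ≳ R
proved, e.g. already for free flight on 𝒟^⊥, or collisions shown not to improve the exponent) ⇒
pivot the completeness input to the commutator line (card classical-mourre-koopman-completeness)
keeping KineticStressDrudeVanishes and (D) — supersede rather than close. ¬RelEntropyVanishing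
closes this route with RelEntropyErgodic, ChaoticMixing, VanishingNoise. GibbsErgodicity (stmt-0779)
proved elsewhere moots (B)–(C) (classification ⇒ completeness) but not (A) or the typed Drude
statement.

NOT DECOMPOSED YET. The infinite-volume objects (locally finite hard-sphere configurations of ℝ³×ℝ³,
Alexander's a.s. flow under regular laws, the Gibbs state g_{z,u,β} at packing < η₀, Spohn's ℋ_U,
the Koopman group and its generator L, quasi-local densities of range R, null densities) —
definition requests, not items; the heat-current and collisional-transfer channels of the Drude
statement (siblings of KineticStressDrudeVanishes, the collisional one needs an impulsive-flux
observable) — filed when (C) is typed; the torus ↔ infinite-volume transfer lemma at fixed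
microscopic window; the constants and the Gibbs weight inside κ(R); the collision-cylinder change of
variables and the a.e. bookkeeping of (A) (prover-level lemmas, `--supports LocalChargesTrivial`);
everything second-order in (D), which belongs to the consumer line and is shared, not re-decomposed
here (D-0019).

CHEAPEST FALSIFIER. Run (B) on the IDEAL GAS restricted to 𝒟^⊥ (densities orthogonal to all one-body
velocity functions): free flight alone must give κ(R) ≍ R by explicit Gaussian integrals (the
measure of range-R pairs not dispersed by time T decays like (R/T)³ per pair); if already that
constant is superlinear the scheme is dead before collisions enter; if linear, the line lives or
dies on whether collisions improve the exponent, testable next on the Rayleigh-gas (linear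
Boltzmann) caricature where everything is explicit. Done here by inspection only: the typed
KineticStressDrudeVanishes correctly FAILS at σ = 0 (free flight conserves S, plateau θ²), and the
MD record (AlderGassWainwright1970, doi:10.1063/1.1673845: finite shear viscosity of the hard-sphere
fluid at all fluid densities, integrable stress autocorrelation) is consistent with it; an
event-driven MD measurement of the Cesàro plateau versus L at φ = 0.05–0.2, N ≈ 10³, is the cheapest
numerical refutation and was not run in this one-shot unit.

NUMBERS. d = 3 throughout (d = 1 hard rods: every φ is a collision invariant, (A) false — the
statement is typed over Fin 3). Collision invariants in d = 3: exactly the 5-dimensional span{1, v₁,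
v₂, v₃, |v|²} (Cercignani1990; CercignaniIllnerPulvirenti1994 §3.1). Number of collisions of N balls
in ℝ³: finite on every non-degenerate orbit (Vaserstein1979, Illner1989), with a bound uniform in
the data and super-exponential in N (BuragoFerlegerKononenko1998 Thm 1). Microscopic units of the
typed Drude statement: diameter ε_N = σ(N+1)^{-1/3}, mean free path ≍ ε_N/(6√2 φ) with packing φ =
πσ³/6, window τ = L ε_N, normalisation (N+1)⁻¹, finite-N conserved-product residue θ²/(N+1).
Critical exponent of the line: κ(R) = o(R) needed, κ ≍ R trivial (dispersal time ≍ R), bet κ ≲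
R^{1−a}. Items at open: 6 typed (1 target, 2 cruxes, 2 supports, 1 assembly) + 4 informal to file =
10 ≤ 15; cruxes 5 ≤ 7.

DEFINITION REQUESTS. (1) InfiniteHardSphereFlow — locally finite marked configurations of ℝ³×ℝ³ with
hard-core exclusion, translation action, Alexander1975's a.s.-defined infinite-volume flow under
translation-invariant regular laws, and the low-density Gibbs states g_{z,u,β} (DLR / Ruelle cluster
expansion); the same request is recorded in the notes of stmt-AtomisticToContinuum-0779 and serves
cards local-flux-gibbsianity-ballwise, hydrodynamic-projection-transplant,
classical-mourre-koopman-completeness. (2) HardSphereFluctuationSpace — Spohn1991 §7.1: ℋ_U =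
closure of local (cell) observables under ⟨⟨a, b⟩⟩ = ∫dx Cov_{g_U}(a, τ_x b), the unitary Koopman
group U_t and its generator L on ℋ_U, the five charges 𝒞, quasi-local densities of range R and null
densities 𝒩 (zero charge on every finite cloud). Both filed with `ledger workitem add --kind
definition` right after open, `--for` the SublinearDispersalStability item. Cite facts wanted: none
beyond the bib keys added this session (Vaserstein1979, Illner1989, Illner1990, Arkeryd1972,
Cercignani1990, AlderGassWainwright1970).

Novelty: Searches (2026-08-15; the hub's local full-text index answered `connection reset` all session and
OpenAlex was rate-limited, so the remote cascade was crossref/arXiv/S2 plus the local vector index):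
`lit search --source crossref` ×9 ("Arkeryd Cercignani functional equation summational invariants" →
doi:10.1007/bf01026552 Cercignani 1990 'Are there more than five linearly-independent collision
invariants'; "Wennberg entropy dissipation summational invariant" → doi:10.1007/bf02183613;
"Gurevich Suhov stationary solutions Bogoliubov hierarchy" → doi:10.1007/bf01608637, bf01609838,
bf01208482; "Burago Ferleger Kononenko number of collisions" → doi:10.2307/120962; "Illner number of
collisions hard sphere all space" → doi:10.1080/00411458908214499, doi:10.1080/00411459008260824;
"Vaserstein finite-range repulsive" → doi:10.1007/bf01941323; "Shiraishi absence of local conserved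
quantities" → doi:10.1209/0295-5075/128/17002, doi:10.1103/physrevb.109.035123,
doi:10.1103/physrevb.111.195130, doi:10.1007/s10955-024-03267-y, doi:10.1063/5.0268742 — all quantum
lattice; "local conserved quantities hard sphere gas ergodicity" → only doi:10.1088/1742-5468/ab5d0c
(1-D hard point gas) and doi:10.1016/0378-4371(81)90012-1 (Lorentz gas); "hydrodynamic projections
conserved charges finite dimensionality" → doi:10.1007/s00220-022-04310-3,
doi:10.1007/s10955-021-02863-6, doi:10.1007/s00023-023-01304-2); `lit search --source arxiv` ×3 (0
relevant rows); `lit vsearch "every measurable summational co  [refs: 10.1007/bf01026552, 10.1007/bf02183613, 10.1007/bf01608637, 10.2307/120962, 10.1080/00411458908214499, 10.1080/00411459008260824, 10.1007/bf01941323, 10.1209/0295-5075/128/17002, 10.1103/physrevb.109.035123, 10.1103/physrevb.111.195130, 10.1007/s10955-024-03267-y, 10.1063/5.0268742, 10.1088/1742-5468/ab5d0c, 10.1016/0378-4371(81, 10.1007/s00220-022-04310-3, 10.1007/s10955-021-02863-6, 10.1007/s000]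

Barriers (technique_class: summational-invariants dispersal-stability koopman-kernel): - technique_class: summational-invariants dispersal-stability koopman-kernel
- Literature.Barriers.AtomisticToContinuum.BoltzmannHypothesisBarrier: addressed at the level of
OBSERVABLES, not states — the line never classifies stationary states (the step the barrier and its
Narrow audit name, stmt-0779); it proves the L² dual (Ker_ℋ L = 𝒞) and hands only the flux-level
corollary (zero excess Drude weight) to a perturbative Gronwall (D); the barrier's formal kernel
(ideal gas: every velocity law stationary) is reproduced exactly where it should bite: without
collisions (A) stops at arbitrary φ (infinitely many charges) and KineticStressDrudeVanishes is
false at σ = 0; scope caveat (b) of the barrier says a proof of such an input evades rather than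
contradicts it.
- Literature.Barriers.AtomisticToContinuum.BoltzmannHypothesisBarrierNarrow: same; the flux-level
kernel it isolates (distinct stationary free-gas states with identical Euler currents, non-zero
rest-frame heat current) is again collisionless, and the collisional gap on one-body velocity
functions is precisely what (B) must quantify.
- Literature.Barriers.AtomisticToContinuum.MazurBoundBallisticNarrow: APPLIES as the exact dichotomy
the route lives by (conjunct (2)): the Cesàro plateau of the shear-stress variance vanishes iff the
stress is orthogonal to every conserved vector of the limiting Koopman group, so a hidden extensive
charge overlapping v₁v₂ kills KineticStressDrudeVanishes — that is the kill criterion, and c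

History (route lifecycle, newest last):
- 2026-08-15T13:41:49Z · CLOSED retired — not-a-thesis: assembly does not conclude the sub-problem Statement (operator:999:1257524)

sub-problem: HydrodynamicLimit · status: closed(retired) · opened planner-plancard-AtomisticToContinuum-Hydrody-9460199c-0 2026-08-15T11:40:21Z · rev 0 · ledger route-AtomisticToContinuum-DispersalNoHiddenCharges
GENERATED by the gate from the ledger (D-0016/17). Provers cite these decls: `theorem foo : Summit.AtomisticToContinuum.HydrodynamicLimit.Theses.DispersalNoHiddenCharges.<Decl> := …` in Summits/AtomisticToContinuum/HydrodynamicLimit/Theorems/<Name>.lean.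
-/

namespace Summit.AtomisticToContinuum.HydrodynamicLimit.Theses.DispersalNoHiddenCharges

open scoped BigOperators Topology Manifold Classical MeasureTheory ProbabilityTheory Matrix InnerProductSpace ComplexConjugate ContinuousMap
open Filter Set Function TopologicalSpace MeasureTheory

attribute [summit_statement] _root_.HydrodynamicLimit

/-- item stmt-AtomisticToContinuum-0766 · target · rank 0 · open · by planner
why it might fail: in substance the open conjunct: deterministic spheres may fail to keep local equilibrium on Euler times; with (D) it inherits every failure mode of zero-excess-Drude-weight + second-order response + velocity tails.
sources: OllaVaradhanYau1993, Yau1991, Spohn1991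
[target] X_RE: for all continuous profiles ∃ σ₀ ∀ σ<σ₀ ∀ classical hs-Euler solutions on [0,T) ∀
flows: the initial local Gibbs laws are probability measures and, if their fields converge at t=0,
then ∀ t<T ∃ activity profile a_t such that the reference local Gibbs law (a_t, u_t, θ_t) is a
probability measure whose empirical density/momentum/energy fields concentrate exponentially (≤ C
e^{-(N+1)/C}) around (ρ,ρu,E)(t), and klDiv(lawAt Φ_N (localGibbs a₀u₀θ₀) t ‖ localGibbs a_t u_t
θ_t)/(N+1) → 0. Yau1991; OllaVaradhanYau1993 Thm 1.1 (with noise). -/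
@[route_item "route-AtomisticToContinuum-DispersalNoHiddenCharges"]
def RelEntropyVanishing : Prop :=
  ∀ (a₀ θ₀ : Literature.MathematicalPhysics.KineticTheory.T3 → ℝ) (u₀ : Literature.MathematicalPhysics.KineticTheory.T3 → Literature.MathematicalPhysics.KineticTheory.V3), Continuous a₀ → Continuous θ₀ → Continuous u₀ → (∀ x, 0 < a₀ x) → (∀ x, 0 < θ₀ x) → ∃ σ₀ : ℝ, 0 < σ₀ ∧ ∀ σ : ℝ, 0 < σ → σ < σ₀ → ∀ (T : ℝ) (ρ θ : ℝ → Literature.MathematicalPhysics.KineticTheory.T3 → ℝ) (u : ℝ → Literature.MathematicalPhysics.KineticTheory.T3 → Literature.MathematicalPhysics.KineticTheory.V3), Literature.MathematicalPhysics.KineticTheory.IsHardSphereEulerSolution σ T ρ u θ → ∀ Φ : (N : ℕ) → Literature.Analysis.FluidPDE.HardSphereFlow (Literature.Analysis.FluidPDE.Torus.geometry (Fin 3)) (Literature.MathematicalPhysics.KineticTheory.hsDiameter σ N) (N + 1), (∀ N, MeasureTheory.IsProbabilityMeasure (Literature.MathematicalPhysics.KineticTheory.localGibbsLaw σ a₀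 u₀ θ₀ N (Φ N))) ∧ (Literature.MathematicalPhysics.KineticTheory.TendstoHydroFieldsAt (fun N => Literature.MathematicalPhysics.KineticTheory.localGibbsLaw σ a₀ u₀ θ₀ N (Φ N)) Φ ρ u θ 0 → ∀ t ∈ Set.Ico 0 T, ∃ a : Literature.MathematicalPhysics.KineticTheory.T3 → ℝ, (∀ N, MeasureTheory.IsProbabilityMeasure (Literature.MathematicalPhysics.KineticTheory.localGibbsLaw σ a (u t) (θ t) N (Φ N))) ∧ (∀ χ : Literature.MathematicalPhysics.KineticTheory.T3 → ℝ, Continuous χ → ∀ δ : ℝ, 0 < δ → ∃ C : ℝ, 0 < C ∧ ∀ N : ℕ, Literature.MathematicalPhysics.KineticTheory.localGibbsLaw σ a (u t) (θ t) N (Φ N) {z | δ < |Literature.MathematicalPhysics.KineticTheory.empiricalDensityField z χ - ∫ x, χ x * ρ t x|} ≤ ENNReal.ofReal (C * Real.exp (-(C⁻¹ * (N + 1)))) ∧ Literature.MathematicalPhysics.KineticTheory.localGibbsLaw σ a (u t) (θ t) N (Φ N) {z | δ < ‖Literature.MathematicalPhysics.KineticTheory.empiricalMomentumField z χ - ∫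 x, (χ x * ρ t x) • u t x‖} ≤ ENNReal.ofReal (C * Real.exp (-(C⁻¹ * (N + 1)))) ∧ Literature.MathematicalPhysics.KineticTheory.localGibbsLaw σ a (u t) (θ t) N (Φ N) {z | δ < |Literature.MathematicalPhysics.KineticTheory.empiricalEnergyField z χ - ∫ x, χ x * Literature.MathematicalPhysics.KineticTheory.totalEnergyDensity (ρ t x) (u t x) (θ t x)|} ≤ ENNReal.ofReal (C * Real.exp (-(C⁻¹ * (N + 1))))) ∧ Filter.Tendsto (fun N : ℕ => InformationTheory.klDiv ((Φ N).lawAt (Literature.MathematicalPhysics.KineticTheory.localGibbsLaw σ a₀ u₀ θ₀ N (Φ N)) t) (Literature.MathematicalPhysics.KineticTheory.localGibbsLaw σ a (u t) (θ t) N (Φ N)) / ((N : ENNReal) + 1)) Filter.atTop (nhds 0))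

-- item stmt-AtomisticToContinuum-6125 · crux · rank 2 · closed · moot by None · by planner — informal only, no Lean statement yet:
--   [crux] SUBLINEAR DISPERSAL STABILITY κ(R) = o(R) — card dispersal-no-hidden-charges (B) = (B1)+(B3);
--   the hardest and most informative step of the route. SETTING (definitions requested:
--   InfiniteHardSphereFlow, HardSphereFluctuationSpace): the infinite-volume hard-sphere gas in ℝ³
--   (diameter 1) in its Gibbs state g_U at packing fraction < η₀ (any temperature, zero drift); Spohn's
--   fluctuation space ℋ_U = completion of local observables under ⟨⟨a,b⟩⟩ = ∫dx Cov_{g_U}(a, τ_x b)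
--   (Spohn1991 §7.1, pp. 86–88) — null densities (divergences, antisymmetric pair terms: zero charge on
--   every finite cloud) are

/-- item stmt-AtomisticToContinuum-5206 · crux · rank 3 · closed · moot by None · by planner
why it might fail: Only through step (i): it needs, for every N, that a.e. cloud has a LAST collision and then R-isolates with pairwise distinct outgoing velocities (Vaserstein1979/Illner1989 finiteness, unformalised; d = 1 analogue is false: rods swap velocities) and that z ↦ v_out pushes Liouville to a.c. laws.
sources: Vaserstein1979, Illner1989, BuragoFerlegerKononenko1998, Arkeryd1972, Cercignani1990, CercignaniIllnerPulvirenti1994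
[crux] theorem (A) of card dispersal-no-hidden-charges, stated for finite clouds in ℝ³ as the
novelty audit asked: fix a diameter ε > 0, a range R and a function q of rooted local patterns (the
multiset of (x_j − x_i, v_j) over the spheres j within distance R of sphere i, root included); let
Q_N(z) = Σ_i q(pattern at i). If v ↦ q{(0, v)} is locally integrable and, for every N and every
hard-sphere flow of N spheres of diameter ε in ℝ³, Q_N(Φ_t z) = Q_N(z) for Liouville-a.e. z and all
t, then there are a, c ∈ ℝ, b ∈ ℝ³ with Q_N(z) = Σ_i (a + ⟨b, v_i⟩ + c|v_i|²) for every N and a.e.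
z. Proof plan: N = 2 clouds that collide after being R-separated give φ(v)+φ(w) = φ(v′)+φ(w′) for
a.e. (v, w, n) (collision-cylinder change of variables), φ(v) := q{(0,v)};
MeasurableCollisionInvariant makes φ quadratic a.e.; for general N, FiniteCollisionsAllSpace +
measure preservation give, for a.e. z, a last collision, pairwise distinct outgoing velocities and
eventual R-isolation, so Q_N(z) = Σ_i φ(v_i^out) = N a + ⟨b, P⟩ + 2cE. [deps:
MeasurableCollisionInvariant, FiniteCollisionsAllSpace] [difficulty: M] -/
@[route_item "route-AtomisticToContinuum-DispersalNoHiddenCharges"]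
def LocalChargesTrivial : Prop :=
  ∀ (ε R : ℝ), 0 < ε → ∀ q : Multiset (EuclideanSpace ℝ (Fin 3) × EuclideanSpace ℝ (Fin 3)) → ℝ, let Q : (N : ℕ) → Literature.Analysis.FluidPDE.Config N (Fin 3) (EuclideanSpace ℝ (Fin 3)) → ℝ := fun N z => ∑ i : Fin N, q ((Finset.univ.filter fun j : Fin N => ‖(z j).1 - (z i).1‖ ≤ R).val.map fun j => ((z j).1 - (z i).1, (z j).2)); MeasureTheory.LocallyIntegrable (fun v : EuclideanSpace ℝ (Fin 3) => q {((0 : EuclideanSpace ℝ (Fin 3)), v)}) MeasureTheory.volume → (∀ (N : ℕ) (Φ : Literature.Analysis.FluidPDE.HardSphereFlow (Literature.Analysis.FluidPDE.Euclidean.geometry (Fin 3)) ε N), ∀ᵐ z ∂(Literature.Analysis.FluidPDE.liouville (Literature.Analysis.FluidPDE.Euclidean.geometry (Fin 3)) N ε), ∀ t : ℝ, Q N (Φ.flow t z) = Q N z) → ∃ (a c : ℝ) (b : EuclideanSpace ℝ (Fin 3)), ∀ N : ℕ, ∀ᵐ z ∂(Literature.Analysis.FluidPDE.liouville (Literature.Analysis.FluidPDE.Euclidean.geometry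 (Fin 3)) N ε), Q N z = ∑ i : Fin N, (a + inner ℝ b (z i).2 + c * ‖(z i).2‖ ^ 2)

/-- item stmt-AtomisticToContinuum-5207 · crux · rank 4 · closed · moot by None · by planner
why it might fail: False for the ideal gas (S conserved: plateau θ²) and whenever an extensive conserved charge overlaps v₁v₂ (Mazur); at fixed σ a slow non-hydrodynamic mode or a stress autocorrelation that is not Cesàro-null keeps the plateau positive; no theorem controls time correlations of deterministic spheres.
sources: Spohn1991, Doyon2022, Mazur1969, AlderGassWainwright1970, Literature.Barriers.AtomisticToContinuum.MazurBoundBallisticNarrow, OllaVaradhanYau1993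
[crux] the consumable output of (C) on the conjunct's own objects (D1 of card
local-flux-gibbsianity-ballwise, kinetic shear-stress channel; crux B of
hydrodynamic-projection-transplant and (ii) of classical-mourre-koopman-completeness in Cesàro
form): for every temperature θ > 0 there is σ₀ > 0 such that for 0 < σ < σ₀, every family of torus
hard-sphere flows Φ_N of N+1 spheres of diameter ε_N = σ(N+1)^{-1/3}, and every δ > 0, there is L₀
with: for all L ≥ L₀, eventually in N, E_{G_N}[ (τ⁻¹ ∫_0^τ S(Φ_{N,s} z) ds)² ] ≤ δ (N+1), where τ =
L ε_N (time to fly L diameters ≍ L·σ³ mean free times), S(z) = Σ_i v_{i,1} v_{i,2} (kinetic shear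
stress, orthogonal under G_N to particle number, momentum and energy by reflection symmetry) and G_N
= localGibbsLaw σ 1 0 θ (constant profiles — activity cancels in the canonical normalisation: the
flow-invariant canonical hard-sphere Gibbs law with Maxwellian velocities at temperature θ).
Equivalently lim_L limsup_N (N+1)⁻¹ Var(time average) = 0: no excess (non-hydrodynamic) Drude weight
in the shear channel, N → ∞ BEFORE L → ∞ (finite-N products such as P₁P₂ contribute θ²/(N+1) only).
[deps: LocalChargesTrivial] [difficulty: open-problem] -/
@[route_item "route-AtomisticToContinuum-DispersalNoHiddenCharges"]
def KineticStressDrudeVanishes : Prop :=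
  ∀ θ : ℝ, 0 < θ → ∃ σ₀ : ℝ, 0 < σ₀ ∧ ∀ σ : ℝ, 0 < σ → σ < σ₀ → ∀ Φ : (N : ℕ) → Literature.Analysis.FluidPDE.HardSphereFlow (Literature.Analysis.FluidPDE.Torus.geometry (Fin 3)) (Literature.MathematicalPhysics.KineticTheory.hsDiameter σ N) (N + 1), ∀ δ : ℝ, 0 < δ → ∃ L₀ : ℝ, 0 < L₀ ∧ ∀ L : ℝ, L₀ ≤ L → ∀ᶠ N : ℕ in Filter.atTop, ∫⁻ z, ENNReal.ofReal (((L * Literature.MathematicalPhysics.KineticTheory.hsDiameter σ N)⁻¹ * ∫ s in (0 : ℝ)..(L * Literature.MathematicalPhysics.KineticTheory.hsDiameter σ N), ∑ i : Fin (N + 1), ((Φ N).flow s z i).2 0 * ((Φ N).flow s z i).2 1) ^ 2) ∂(Literature.MathematicalPhysics.KineticTheory.localGibbsLaw σ (fun _ => 1) (fun _ => 0) (fun _ => θ) N (Φ N)) ≤ ENNReal.ofReal (δ * (N + 1))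

-- item stmt-AtomisticToContinuum-6149 · support · rank 5 · closed · moot by None · by planner — informal only, no Lean statement yet:
--   [crux] DISPERSAL CRITERION — card dispersal-no-hidden-charges (B2)+(B3): LocalChargesTrivial ∧
--   SublinearDispersalStability ∧ (ℋ-light-cone) ⇒ CompletenessHS: Ker_{ℋ_U} L = 𝒞 for the infinite
--   hard-sphere gas at packing < η₀ (the Koopman-invariant vectors of Spohn's fluctuation space are
--   exactly the five charges — pseudo-local completeness, the 'non-integrability theorem' no interacting
--   continuum system has; = crux B of card hydrodynamic-projection-transplant, target of
--   classical-mourre-koopman-completeness, 3(b) of ld-drude-flux-gibbsianity). MECHANISM: let ξ ∈ Ker L,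
--   ξ ⊥ 𝒞, ‖ξ‖ = 1; approximat

-- item stmt-AtomisticToContinuum-6193 · support · rank 6 · closed · moot by None · by planner — informal only, no Lean statement yet:
--   [crux] COMPLETENESS TO EULER — the consumer step named by card dispersal-no-hidden-charges; it IS
--   the sufficiency theorem of card local-flux-gibbsianity-ballwise with its linear half supplied by
--   this route (shared node: when that card is routed, attach/merge — D-0019, not a rival
--   decomposition). CLAIM: for the hard-sphere gas at packing < η₀: [zero excess Drude weight of every
--   projected current — KineticStressDrudeVanishes and its heat-current / collisional-transfer siblings,
--   = first order] ∧ [LOCAL FLUX-GIBBSIANITY at second order: ∃ β₀ > 0 such that every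
--   translation-invariant, flow-invarian

/-- item stmt-AtomisticToContinuum-5208 · support · rank 9 · closed · moot by None · by planner
sources: Arkeryd1972, Cercignani1990, CercignaniIllnerPulvirenti1994
[support] measurable Boltzmann–Gronwall lemma in ℝ³ with unnormalised impact directions (the tree's
`reflectVel`): a locally integrable φ : ℝ³ → ℝ with φ(v) + φ(w) = φ(v′) + φ(w′) for Lebesgue-a.e.
(v, w, n), (v′, w′) = reflectVel n (v, w), agrees a.e. with a + ⟨b, v⟩ + c|v|². Route: Galilean
shifts preserve the equation, so mollification reduces to the smooth case
(CercignaniIllnerPulvirenti1994 §3.1; Arkeryd1972; Cercignani1990), and the 5-dimensional target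
space is closed under a.e. limits. [difficulty: provable-now] -/
@[route_item "route-AtomisticToContinuum-DispersalNoHiddenCharges"]
def MeasurableCollisionInvariant : Prop :=
  ∀ φ : EuclideanSpace ℝ (Fin 3) → ℝ, MeasureTheory.LocallyIntegrable φ MeasureTheory.volume → (∀ᵐ p : EuclideanSpace ℝ (Fin 3) × (EuclideanSpace ℝ (Fin 3) × EuclideanSpace ℝ (Fin 3)) ∂MeasureTheory.volume, φ p.1 + φ p.2.1 = φ (Literature.Analysis.FluidPDE.reflectVel p.2.2 (p.1, p.2.1)).1 + φ (Literature.Analysis.FluidPDE.reflectVel p.2.2 (p.1, p.2.1)).2) → ∃ (a c : ℝ) (b : EuclideanSpace ℝ (Fin 3)), ∀ᵐ v : EuclideanSpace ℝ (Fin 3) ∂MeasureTheory.volume, φ v = a + inner ℝ b v + c * ‖v‖ ^ 2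

/-- item stmt-AtomisticToContinuum-5209 · support · rank 9 · closed · moot by None · by planner
sources: Vaserstein1979, Illner1989, BuragoFerlegerKononenko1998, Alexander1975
[support] finitely many collisions in all space (Vaserstein1979; Illner1989 =
doi:10.1080/00411458908214499, Illner1990 = doi:10.1080/00411459008260824; uniform bounds
BuragoFerlegerKononenko1998): for every ε > 0, N and hard-sphere flow of N spheres of diameter ε in
ℝ³ (Alexander's theorem in ℝ³ is the tree theorem
`Literature.Analysis.FluidPDE.HardSphereFlow.nonempty_holds`), for Liouville-a.e. datum the set of
all collision times of its orbit is finite. Print proves it for every non-degenerate orbit; the a.e.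
form is what (A) consumes. [difficulty: L] -/
@[route_item "route-AtomisticToContinuum-DispersalNoHiddenCharges"]
def FiniteCollisionsAllSpace : Prop :=
  ∀ (ε : ℝ), 0 < ε → ∀ (N : ℕ) (Φ : Literature.Analysis.FluidPDE.HardSphereFlow (Literature.Analysis.FluidPDE.Euclidean.geometry (Fin 3)) ε N), ∀ᵐ z ∂(Literature.Analysis.FluidPDE.liouville (Literature.Analysis.FluidPDE.Euclidean.geometry (Fin 3)) N ε), (Literature.Analysis.FluidPDE.collisionTimes (Literature.Analysis.FluidPDE.Euclidean.geometry (Fin 3)) ε (fun t => Φ.flow t z)).Finite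

-- item stmt-AtomisticToContinuum-6202 · support · rank 9 · closed · moot by None · by planner — informal only, no Lean statement yet:
--   [support] COMPLETENESS TO DRUDE (bookkeeping; card crux 3): CompletenessHS (Ker_{ℋ_U} L = 𝒞) ⇒
--   KineticStressDrudeVanishes, and likewise zero Cesàro Drude weight for every local current orthogonal
--   to 𝒞 (heat current minus (5/2)θ·p, collisional momentum/energy transfer minus Gibbs values) — the D1
--   input of card local-flux-gibbsianity-ballwise in all channels. TWO STEPS: (i) HILBERT SPACE
--   (tree-proved): for a strongly continuous contraction/unitary group U_t on a real Hilbert space and A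
--   ⊥ every conserved vector, τ⁻¹∫_0^τ ⟨U_t A, A⟩ dt → 0 and ‖τ⁻¹∫_0^τ U_t A dt‖² → ‖P A‖² = 0 (von
--   Neumann / Suzu

/-- item stmt-AtomisticToContinuum-0769 · assembly · rank 1 · open · by planner
sources: KipnisLandim1999, OllaVaradhanYau1993, Yau1991
[assembly] X_RE → HydrodynamicLimit: entropy inequality μ(A) ≤ (log 2 + H(μ|λ))/log(1 + 1/λ(A))
(from Donsker–Varadhan / Mathlib klDiv API) with λ(A) ≤ C e^{-(N+1)/C} and H = o(N) gives μ(A) → 0;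
μ = lawAt (Φ N) P t = P.map (flow t) turns μ{z | δ < |field z − ·|} into P{z | δ < |field (flow t z)
− ·|} (measurable_flow); the reference concentration is stated for z itself and TendstoHydroFieldsAt
at time 0 of the reference law is not needed. Zero-mass case impossible by the IsProbabilityMeasure
clauses; take σ₀ from X_RE. -/
@[route_item "route-AtomisticToContinuum-DispersalNoHiddenCharges"]
def Assembly : Prop :=
  RelEntropyVanishing → Literature.MathematicalPhysics.KineticTheory.HydrodynamicLimit

end Summit.AtomisticToContinuum.HydrodynamicLimit.Theses.DispersalNoHiddenCharges
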